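import Literature.NumberTheory.QuadraticFields.GaussianQuarticSymbol
import Literature.NumberTheory.EllipticCurves.CongruentNumberCurveHeckeSeries
import HarnessLib

/-!
# STUB-PLAN P1b (quartic theta dictionary), theta side I — the symbols: `(·/3)₄` as the P6 table, the `3`-splitting
# `(D/y)₄ = (y/3)₄^k (A/y)₄`, and the period `8|D|` of `(D/·)₄` on primary arguments (Q1d)

Summit `BirchSwinnertonDyer`, crux `InertBadAtThree` (stmt-BirchSwinnertonDyer-19225; K8 `InertBadSignedBranches` r4 / BED
`BiquadraticEisensteinDescent` r5), line of record `Cruxes/InertBadAtThree/Lines/rubin_e1_inert_three.lean` v5 (lead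
`bsd-line-ibd-p1`), registered stub `stub_plainOddNeronIntegralThreeQuartic`; STUB-PLAN
`Cruxes/InertBadAtThree/STUB-PLAN-neronIntegralThreeQuartic-bsd-idea-18-g8.md` piece **P1b `stub_quarticThetaDictionary`**,
refined in `Cruxes/InertBadAtThree/QUARTIC_DICTIONARY_PLAN_bsd_idea_18_g9.lean` (v2) into Q1–Q8.  This file (width seat
bsd-wall-cm-bed-w2 g9, `--supports 19225`, helper) supplies the facts about the tree's concrete symbols
`GaussianQuarticSymbol.quarticSymbolInt D x = (D/x)₄` and `GaussianQuarticSymbol.quarticCharThree x = (x/3)₄` that the theta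
coefficient needs: §1 `(x/3)₄` read in `ℂ` IS the residue table `hq` of the P6 assembly `…QuarticCleanAssembly`, has period `3`,
and is real on units; §2 for `D = (−3)^k A` and primary `y`, `(D/y)₄ = (y/3)₄^k (A/y)₄` GIVEN `(−3/y)₄ = (y/3)₄` (Q2, Ireland–Rosen
Prop. 9.9.8 at `a = −3`, hypothesis — width seat w4's values file); §3 **Q1d**: `(D/(x + 8|D|y))₄ = (D/x)₄` for primary `x`
(Ireland–Rosen, Ch. 18 §6, proof of Thm 7, «`α ≡ 1 (8D)` implies `(D/α)₄ = 1`»: the coprime case is the landed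
`quarticSymbolInt_eq_of_dvd_sub`; a common prime of `x` and `D` divides `x + 8|D|y` too and both sides vanish, `χ_π(0) = 0`).
HONEST FRAMING: bookkeeping on `ℤ[i]`; nothing here proves the stub, the crux or BSD.  No definitions, no named facts, no
`sorry`; axioms standard.
-/

set_option linter.dupNamespace false
set_option autoImplicit false

noncomputable section

open scoped ComplexConjugate
open Complex Zsqrtd
open Literature.NumberTheory.QuadraticFields Literature.NumberTheory.QuadraticFields.GaussianPrimary
open Literature.NumberTheory.QuadraticFields.GaussianQuarticSymbol
open Literature.NumberTheory.EllipticCurves Literature.NumberTheory.EllipticCurves.GaussianPrimary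
open Literature.NumberTheory.EllipticCurves.ModularForms
open Literature.NumberTheory.LFunctions Literature.NumberTheory.LFunctions.GaussianTheta

namespace Summit.BirchSwinnertonDyer.BirchSwinnertonDyer.Theorems.InertBadSignedBranchesInertBadAtThreeQuarticTheta

/-! ## §1 `(·/3)₄`: the table in `ℂ`, period `3`, reality on units -/

/-- The tree's `ℤ[i]`-valued `(x/3)₄` read in `ℂ` is the residue table used by the P6 assembly (hypothesis shape `hq` of
`…QuarticCleanAssembly`). [folklore] -/
theorem toComplex_quarticCharThree (x : GaussianInt) :
    ((quarticCharThree x : GaussianInt) : ℂ) =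
      if (3 : ℤ) ∣ x.re ∧ (3 : ℤ) ∣ x.im then 0
      else if (3 : ℤ) ∣ x.im then 1
      else if (3 : ℤ) ∣ x.re then -1
      else if (3 : ℤ) ∣ x.re - x.im then -I
      else I := by
  unfold quarticCharThree
  split_ifs <;> simp [GaussianInt.toComplex_def']

/-- `(·/3)₄` is periodic modulo `3`. [folklore] -/
theorem quarticCharThree_add_three_mul (x y : GaussianInt) :
    quarticCharThree (x + 3 * y) = quarticCharThree x := by
  have h3 : (3 : GaussianInt) = ⟨3, 0⟩ := rfl
  have hre : (x + 3 * y).re = x.re + 3 * y.re := by rw [h3]; simp [Zsqrtd.re_add, Zsqrtd.re_mul]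
  have him : (x + 3 * y).im = x.im + 3 * y.im := by rw [h3]; simp [Zsqrtd.im_add, Zsqrtd.im_mul]
  have e1 : (3 : ℤ) ∣ (x + 3 * y).re ↔ (3 : ℤ) ∣ x.re := by
    rw [hre]; exact dvd_add_left (dvd_mul_right 3 y.re)
  have e2 : (3 : ℤ) ∣ (x + 3 * y).im ↔ (3 : ℤ) ∣ x.im := by
    rw [him]; exact dvd_add_left (dvd_mul_right 3 y.im)
  have e3 : (3 : ℤ) ∣ (x + 3 * y).re - (x + 3 * y).im ↔ (3 : ℤ) ∣ x.re - x.im := by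
    rw [hre, him, show x.re + 3 * y.re - (x.im + 3 * y.im) = x.re - x.im + 3 * (y.re - y.im) by ring]
    exact dvd_add_left (dvd_mul_right 3 _)
  unfold quarticCharThree
  simp only [e1, e2, e3]

/-- `(u(x)/3)₄ ∈ {0, 1, −1}`: `conj` fixes `((u(x)/3)₄ : ℂ)`. [folklore] -/
theorem star_quarticCharThree_primaryUnit (x : GaussianInt) :
    star (quarticCharThree (primaryUnit x)) = quarticCharThree (primaryUnit x) := by
  unfold primaryUnit
  split_ifs <;> decide

/-! ## §2 The `3`-splitting of `(D/·)₄` on primary arguments (modulo Q2) -/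

/-- **Q8c for the quartic symbol**: `(D/y)₄ = (y/3)₄^k (A/y)₄` for `D = (−3)^k A` and primary `y`, GIVEN the value
`(−3/y)₄ = (y/3)₄` (Ireland–Rosen Prop. 9.9.8 with `a = −3`; hypothesis `hneg3`, width seat w4's values file) — from the landed
`quarticSymbolInt_mul_left` / `quarticSymbolInt_pow_left`. [folklore] -/
theorem quarticSymbolInt_threeSplit
    (hneg3 : ∀ y : GaussianInt, IsPrimary y → quarticSymbolInt (-3) y = quarticCharThree y)
    {D A : ℤ} {k : ℕ} (hDA : D = (-3) ^ k * A) {y : GaussianInt} (hy : IsPrimary y) :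
    quarticSymbolInt D y = quarticCharThree y ^ k * quarticSymbolInt A y := by
  rw [hDA, quarticSymbolInt_mul_left, quarticSymbolInt_pow_left _ _ hy, hneg3 y hy]

/-! ## §3 Q1d — `(D/·)₄` is periodic modulo `8|D|` on primary arguments -/

/-- `(D/x)₄ = 0` as soon as a prime `π` divides both `x ≠ 0` and `D` (`χ_π(D) = χ_π(0) = 0` is a factor).
[folklore] -/
theorem quarticSymbolInt_eq_zero_of_prime_dvd {D : ℤ} {π x : GaussianInt} (hπ : Prime π)
    (hπD : π ∣ (D : GaussianInt)) (hπx : π ∣ x) (hx : x ≠ 0) : quarticSymbolInt D x = 0 := by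
  obtain ⟨w, rfl⟩ := hπx
  have hw : w ≠ 0 := right_ne_zero_of_mul hx
  rw [quarticSymbolInt_mul D hπ.ne_zero hw]
  suffices h : quarticSymbolInt D π = 0 by rw [h, zero_mul]
  have hπK : Prime (Φ₄ π) := (MulEquiv.prime_iff (Φ₄ : GaussianInt ≃* NumberField.RingOfIntegers K₄)).mpr hπ
  let 𝔭 : IsDedekindDomain.HeightOneSpectrum (NumberField.RingOfIntegers K₄) :=
    ⟨Ideal.span {Φ₄ π}, (Ideal.span_singleton_prime hπK.ne_zero).mpr hπK,
      by rw [Ne, Ideal.span_singleton_eq_bot]; exact hπK.ne_zero⟩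
  apply Φ₄.injective
  rw [map_quarticSymbolInt, map_zero,
    Literature.NumberTheory.GaloisRepresentations.quarticSymbol_span_of_span_eq (𝔭 := 𝔭) rfl]
  have h0 : Ideal.Quotient.mk 𝔭.asIdeal (D : NumberField.RingOfIntegers K₄) = 0 := by
    rw [Ideal.Quotient.eq_zero_iff_mem, show 𝔭.asIdeal = Ideal.span {Φ₄ π} from rfl, Ideal.mem_span_singleton,
      show (D : NumberField.RingOfIntegers K₄) = Φ₄ (D : GaussianInt) from (map_intCast Φ₄ D).symm, map_dvd_iff]
    exact hπD
  rw [h0]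
  exact Literature.NumberTheory.GaloisRepresentations.quarticResidueSymbol_zero isPrimitiveRoot_ζ₄ 𝔭

/-- **Q1d — periodicity of `x ↦ (D/x)₄` modulo `8|D|` on primary arguments** (Ireland–Rosen, Ch. 18 §6, proof of Theorem 7:
«`α ≡ 1 (8D)` implies `(D/α)₄ = 1`»; landed for `x` prime to `8D` as `quarticSymbolInt_eq_of_dvd_sub`; if a prime of `ℤ[i]`
divides `x` and `D` it divides `x + 8|D|y` as well and both sides are `0`). [folklore] -/
theorem quarticSymbolInt_add_mul_of_isPrimary {D : ℤ} (hD : D ≠ 0) {x : GaussianInt} (hx : IsPrimary x)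
    (y : GaussianInt) :
    quarticSymbolInt D (x + ((8 * |D| : ℤ) : GaussianInt) * y) = quarticSymbolInt D x := by
  -- `8|D| = ± 8D`
  obtain ⟨ε, hε, hεD⟩ : ∃ ε : ℤ, (ε = 1 ∨ ε = -1) ∧ (8 * |D| : ℤ) = ε * (8 * D) := by
    rcases le_or_gt 0 D with h | h
    · exact ⟨1, Or.inl rfl, by rw [abs_of_nonneg h]; ring⟩
    · exact ⟨-1, Or.inr rfl, by rw [abs_of_neg h]; ring⟩
  set x' : GaussianInt := x + ((8 * |D| : ℤ) : GaussianInt) * y with hx'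
  have hdvd : ((8 * D : ℤ) : GaussianInt) ∣ x' - x := ⟨(ε : GaussianInt) * y, by rw [hx', hεD]; push_cast; ring⟩
  -- `x'` is odd (indeed primary), hence nonzero
  have hx'p : IsPrimary x' := by
    have : x' = x + ((4 * (2 * D.natAbs) : ℕ) : GaussianInt) * y := by
      rw [hx', show (8 * |D| : ℤ) = ((4 * (2 * D.natAbs) : ℕ) : ℤ) by
        rw [← Int.natCast_natAbs]; push_cast; ring, Int.cast_natCast]
    rw [this]
    exact (isPrimary_add_natCast_mul_iff (dvd_mul_right 4 _) _ _).mpr hx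
  have hx0 : x ≠ 0 := hx.ne_zero
  have hx'0 : x' ≠ 0 := hx'p.ne_zero
  by_cases hcop : IsCoprime x ((8 * D : ℤ) : GaussianInt)
  · -- coprime case: the landed modulus-`8D` lemma
    exact quarticSymbolInt_eq_of_dvd_sub hD hx'0 hx0 hcop hdvd
  · -- a common prime factor `π` of `x` and `8D`; `π ∤ 2` since `x` is odd, so `π ∣ D`
    obtain ⟨π, hπ, hπx, hπ8D⟩ : ∃ π : GaussianInt, Prime π ∧ π ∣ x ∧ π ∣ ((8 * D : ℤ) : GaussianInt) := by
      by_contra h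
      push Not at h
      exact hcop ((UniqueFactorizationMonoid.isRelPrime_iff_no_prime_factors hx0).mpr
        (fun {d} hdx hd8 hd ↦ h d hd hdx hd8) |>.isCoprime)
    have hπodd : ¬ π ∣ (2 : GaussianInt) := by
      intro h2
      have hn' := norm_dvd_norm hπx
      have h2n : π.norm ∣ (2 : GaussianInt).norm := norm_dvd_norm h2
      rw [show (2 : GaussianInt).norm = 4 by decide] at h2n
      -- `N π ∣ 4` and `N π ∣ N x` odd ⇒ `N π = 1`, contradicting primality
      have hxodd : x.norm % 2 = 1 := hx.norm_odd
      have hNπ : π.norm = 1 := by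
        have h0 : 0 ≤ π.norm := GaussianInt.norm_nonneg π
        have hle : π.norm ≤ 4 := Int.le_of_dvd (by norm_num) h2n
        obtain ⟨c, hc⟩ := hn'
        interval_cases h : π.norm
        · exfalso; rw [hc] at hxodd; simp at hxodd
        · rfl
        · exfalso; rw [hc, Int.mul_emod] at hxodd; simp at hxodd
        · exfalso; exact absurd h2n (by decide)
        · exfalso; rw [hc, Int.mul_emod] at hxodd; simp at hxodd
      exact hπ.not_unit ((Zsqrtd.norm_eq_one_iff' (by norm_num) π).mp hNπ)
    have hπD : π ∣ (D : GaussianInt) := by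
      have h8D : ((8 * D : ℤ) : GaussianInt) = 2 * 2 * 2 * (D : GaussianInt) := by push_cast; ring
      rw [h8D] at hπ8D
      rcases hπ.dvd_or_dvd hπ8D with h | h
      · rcases hπ.dvd_or_dvd h with h | h
        · rcases hπ.dvd_or_dvd h with h | h <;> exact absurd h hπodd
        · exact absurd h hπodd
      · exact h
    have hπx' : π ∣ x' := by
      have : x' = x + (x' - x) := by ring
      rw [this]
      exact dvd_add hπx ((hπD.mul_left _).trans (by
        rw [show ((8 * D : ℤ) : GaussianInt) = (8 : GaussianInt) * (D : GaussianInt) by push_cast; ring] at hdvd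
        exact hdvd))
    rw [quarticSymbolInt_eq_zero_of_prime_dvd hπ hπD hπx' hx'0, quarticSymbolInt_eq_zero_of_prime_dvd hπ hπD hπx hx0]

end Summit.BirchSwinnertonDyer.BirchSwinnertonDyer.Theorems.InertBadSignedBranchesInertBadAtThreeQuarticTheta

end
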